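import Summits.NavierStokesRegularity.FluidComputer.ClayBreakdownWitness
import Summits.NavierStokesRegularity.FluidComputer.PalasekTowerViscosity

/-!
# One witness at one viscosity gives Clay (C) (modulo the forced Cor. 11.4)

Cell `ns-blowup`, seat `ns-blowup-ecbridge-1`; companion of `ClayBreakdownWitness.lean` and
`PalasekTowerViscosity.lean` (LABEL: E-C; WHAT THIS IS NOT: not Navier–Stokes evidence — a change
of variables and an assembly). The rate-free endpoint `BreakdownWitness ν` is covariant under the
viscosity scaling `u ↦ a·u(a t, x)`, `p, f ↦ a²·(p, f)(a t, x)` (`a = ν/μ`), exactly like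
`Realisation.rescale`; hence the final form of the cell's typed E-C statement:
`navierStokesBreakdownR3_of_witness : 0 < μ → BreakdownWitness μ →
tao_unconditional_uniqueness_velocity_forced → NavierStokesBreakdownR3` — ONE exact forced
blow-up with Clay data, a Clay-class force smooth through the blow-up time and a locally unbounded
velocity, at ONE viscosity, proves Fefferman's (C) as soon as Tao's Cor. 11.4 is vendored with its
force slot. [cite: FeffermanClay2006, (C)] [cite: Tao2011, Cor. 11.4 and footnote 3]
-/

noncomputable section

namespace Summit.NavierStokesRegularity.FluidComputer.PalasekTowerClayBridge

open Set MeasureTheory Filter Topology Function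
open scoped ENNReal ContDiff NNReal
open Literature.Analysis.FluidPDE
open Summit.NavierStokesRegularity.NavierStokesRegularity.Theorems

namespace BreakdownWitness

variable {μ ν : ℝ}

/-- **Change of viscosity for witnesses** (time dilation by `a = ν/μ`; blow-up time `T/a`, same
ball; unboundedness is preserved since `|a·u(a t, x)| = a |u(a t, x)|`). [cite: Tao2011, footnote 3] -/
def rescale (W : BreakdownWitness μ) (hμ : 0 < μ) (hν : 0 < ν) : BreakdownWitness ν :=
  let a : ℝ := ν / μ
  have ha : 0 < a := div_pos hν hμ
  have haμ : a * μ = ν := div_mul_cancel₀ ν hμ.ne'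
  have hmaps : MapsTo (fun s => a * s) (Ico (0 : ℝ) (W.T / a)) (Ico 0 W.T) := fun s hs =>
    ⟨mul_nonneg ha.le hs.1, by
      have := mul_lt_mul_of_pos_left hs.2 ha
      rwa [mul_div_cancel₀ _ ha.ne'] at this⟩
  { T := W.T / a
    T_pos := div_pos W.T_pos ha
    u := timeRescale a a W.u
    p := timeRescale a (a ^ 2) W.p
    f := timeRescale a (a ^ 2) W.f
    classical := by
      have h := isClassicalNSSolutionOn_viscosityChange W.classical a hmaps
        (uniqueDiffOn_Ico 0 (W.T / a))
      rwa [haμ] at h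
    datum_decay := by
      rw [timeRescale_zero]
      exact hasRapidSpatialDecay_const_smul W.datum_decay
        (W.classical.contDiff_velocity (t := 0) ⟨le_rfl, W.T_pos⟩) a
    force_smooth := isSmoothOnHalfSpace_timeRescale W.force_smooth ha.le _
    force_decay := hasRapidSpaceTimeDecay_timeRescale W.force_smooth W.force_decay ha _
    energy := by
      intro T' hT'
      have haT' : a * T' < W.T := by
        have := mul_lt_mul_of_pos_left hT' ha
        rwa [mul_div_cancel₀ _ ha.ne'] at this
      obtain ⟨C, hC, hb⟩ := W.energy (a * T') haT'
      refine ⟨ENNReal.ofReal (a ^ 2) * C, ENNReal.mul_lt_top ENNReal.ofReal_lt_top hC,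
        fun t ht => ?_⟩
      simp only [timeRescale_apply]
      rw [lintegral_enorm_sq_const_smul]
      exact mul_le_mul_right (hb (a * t) ⟨mul_nonneg ha.le ht.1,
        mul_le_mul_of_nonneg_left ht.2 ha.le⟩) _
    radius := W.radius
    unbounded := by
      intro M
      obtain ⟨t, ht, x, hxR, hM⟩ := W.unbounded (M / a)
      refine ⟨t / a, ⟨div_nonneg ht.1 ha.le, div_lt_div_of_pos_right ht.2 ha⟩, x, hxR, ?_⟩
      rw [timeRescale_apply, mul_div_cancel₀ _ ha.ne', norm_smul, Real.norm_of_nonneg ha.le]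
      rwa [div_lt_iff₀' ha] at hM }

end BreakdownWitness

/-- **The E-C endpoint, final form: one witness at one viscosity.** An exact classical solution of
the forced Navier–Stokes system on `[0, T) × ℝ³` from a Clay datum, with a Clay-class force smooth
through `T`, finite energy on closed slabs and locally unbounded velocity as `t ↑ T`, at a single
viscosity `μ > 0`, implies Fefferman's breakdown statement (C) at every viscosity — given Tao's
unconditional uniqueness with its force slot. [cite: FeffermanClay2006, (C)] [cite: Tao2011, Cor. 11.4] -/
theorem navierStokesBreakdownR3_of_witness {μ : ℝ} (hμ : 0 < μ) (W : BreakdownWitness μ)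
    (hU : tao_unconditional_uniqueness_velocity_forced) :
    Summit.NavierStokesRegularity.NavierStokesRegularity.NavierStokesBreakdownR3 :=
  navierStokesBreakdownR3_of_witnesses hU fun _ν hν => ⟨W.rescale hμ hν⟩

end Summit.NavierStokesRegularity.FluidComputer.PalasekTowerClayBridge

end
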